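import Summits.KontsevichZagierPeriods.KontsevichZagierPeriods.Theses.HurwitzMicroSectors
import Summits.KontsevichZagierPeriods.KontsevichZagierPeriods.Theorems.ReductionTwoSix.Negative.Relative
import Literature.NumberTheory.Transcendental.BoxCoordinatePowerMap
import Literature.NumberTheory.Transcendental.BoxIntegralZetaValues

/-!
# `ReductionTwoSix` (stmt-KontsevichZagierPeriods-3871, route HurwitzMicroSectors) — line `jacobian-monomials`

The crux: every integral representation `r` on the open box `B = (0,1)²` whose integrand agrees on `B`
with `P(xy)/(1 − (xy)⁶)`, `P ∈ ℚ[t]`, is KZ-equivalent to a representation on `B` with integrand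
`a + b/(1 − xy) + c/(1 + xy + x²y²)` for some `a b c : ℚ`.

Line (idea card `jacobian-monomials`: every monomial is a Jacobian). Euclid by `X⁶ − 1`:
`P = R + (X⁶ − 1)·Q`, `deg R < 6`, so on `B` the integrand splits (integrand additivity, rule 1b) as
`R(t)/(1 − t⁶) + (−Q)(t)`, `t = xy`.
* `stub_boxDilation` — the engine (the `n = 2` slice of item DilationMove): for `m ≥ 1` the
  coordinatewise power map `Φₘ(x) = (xᵢᵐ)ᵢ` is ONE change-of-variables move (rule 2) between two
  representations on `B` whose integrands differ by the substitution and the Jacobian `m² (x₀x₁)^(m−1)`.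
* `stub_polynomialPartByJacobians` — THE LEVER: `[Q(xy)]_B ∼ [Σ_k Q_k/(k+1)²]_B`, one dilation
  `m = k+1` per monomial applied to a constant (`(k+1)²(xy)^k` is a Jacobian); no Newton–Leibniz move.
* `stub_polarPartLevelSix` — the level-6 part: for `deg R < 6` there are `b c : ℚ` with
  `[R(t)/(1−t⁶)]_B ∼ [b/(1−t) + c/(1+t+t²)]_B` (the dilations `m = 2, 3` realise the four Hurwitz
  distribution relations among the residue classes `H₀,…,H₅`; exact bookkeeping with `ℚ`-multipliers).
Composition (`reductionTwoSix_proof`): build every intermediate representation on `B` with the landed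
constructor `sectorRep` (integrability from `1/(1−xy) ∈ L¹(B)`, Literature
`box_integral_one_div_one_sub_mul_two`), read integrand additivity in the quotient
`FormalRep ⧸ relations` (`cls_add`), and add the two stub equivalences.

References: M. Kontsevich, D. Zagier, *Periods* (2001), §1.2 rules (1b), (2); J. Milnor, *On
polylogarithms, Hurwitz zeta functions, and the Kubert identities*, Enseign. Math. 29 (1983), §1;
S. Lang, *Cyclotomic Fields I–II* (1990), Ch. 2 §9 (distribution relations).
-/

noncomputable section

open Set MeasureTheory
open scoped BigOperators
open Literature.NumberTheory.Transcendental
open Summit.KontsevichZagierPeriods.HurwitzMicroSectors.ReductionTwoSixNegative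

namespace Summit.KontsevichZagierPeriods.HurwitzMicroSectors.ReductionTwoSix

/-! ## Stubs of the line (registered on stmt-KontsevichZagierPeriods-3871) -/

/-- STUB A (the engine on the open box, `n = 2` slice of item DilationMove). For `m ≥ 1` and two
representations `r, r'` on the open unit box with
`r.integrand x = r'.integrand (xᵢᵐ)ᵢ · m² ∏ᵢ xᵢ^(m−1)` on the box, `[r] − [r']` is ONE
change-of-variables move (`Φₘ x = (xᵢᵐ)ᵢ`: polynomial hence `ℚ`-semialgebraic, injective on the
box with image the box, derivative `diag(m xᵢ^(m−1))`, `|det| = m² ∏ xᵢ^(m−1)`).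
[cite: KontsevichZagier2001, §1.2 rule (2)] -/
theorem stub_boxDilation : ∀ (m : ℕ), 1 ≤ m → ∀ (r r' : KZ.IntegralRep 2), r.domain = {x | ∀ i, x i ∈ Set.Ioo (0:ℝ) 1} → r'.domain = {x | ∀ i, x i ∈ Set.Ioo (0:ℝ) 1} → (∀ x ∈ r.domain, r.integrand x = r'.integrand (fun i => x i ^ m) * ((m : ℝ) ^ 2 * ∏ i, x i ^ (m - 1))) → KZ.of r - KZ.of r' ∈ KZ.changeOfVariablesRel := by
  sorry

/-- STUB B (the lever: every monomial is a Jacobian). Given the box dilations (stub A), a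
representation on the open box with integrand `Q(xy)`, `Q ∈ ℚ[t]`, is KZ-equivalent to the
representation on the box with the CONSTANT integrand `Σ_k Q_k/(k+1)²`: per monomial one dilation
`m = k+1` against a constant (`q·(k+1)²(xy)^k = q ∘ Φ_{k+1} · |det Φ'_{k+1}|`), summed by integrand
additivity. [cite: KontsevichZagier2001, §1.2 rule (2)] -/
theorem stub_polynomialPartByJacobians : (∀ (m : ℕ), 1 ≤ m → ∀ (r r' : KZ.IntegralRep 2), r.domain = {x | ∀ i, x i ∈ Set.Ioo (0:ℝ) 1} → r'.domain = {x | ∀ i, x i ∈ Set.Ioo (0:ℝ) 1} → (∀ x ∈ r.domain, r.integrand x = r'.integrand (fun i => x i ^ m) * ((m : ℝ) ^ 2 * ∏ i, x i ^ (m - 1))) → KZ.of r - KZ.of r' ∈ KZ.changeOfVariablesRel) → ∀ (Q : Polynomial ℚ) (r r' : KZ.IntegralRep 2), r.domain = {x | ∀ i, x i ∈ Set.Ioo (0:ℝ) 1} → r'.domain = {x | ∀ i, x i ∈ Set.Ioo (0:ℝ) 1} → Set.EqOn r.integrand (fun x => Polynomial.aeval (x 0 * x 1) Q) r.domain → Set.EqOn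 r'.integrand (fun _ => ((∑ k ∈ Finset.range (Q.natDegree + 1), Q.coeff k / ((k : ℚ) + 1) ^ 2 : ℚ) : ℝ)) r'.domain → KZ.Equivalent r r' := by
  sorry

/-- STUB C (the level-6 polar part). Given the box dilations (stub A), for `deg R < 6` there are
`b c : ℚ` such that every representation on the open box with integrand `R(xy)/(1 − (xy)⁶)` is
KZ-equivalent to every representation on the box with integrand `b/(1−xy) + c/(1+xy+x²y²)`: the
dilations `m = 2` (`H_r + H_{r+3} ∼ 4H_{2r+1}`) and `m = 3` (`H₁ + H₃ + H₅ ∼ 9H₅`) reduce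
`Σ p_r H_r` to the span of `1/(1−t) = Σ_r t^r/(1−t⁶)` and `1/(1+t+t²) = (1−t+t³−t⁴)/(1−t⁶)` with
explicit rational multipliers (`b = (β+4α)/36`, `c = −α/8`). [cite: Milnor1983, §1] -/
theorem stub_polarPartLevelSix : (∀ (m : ℕ), 1 ≤ m → ∀ (r r' : KZ.IntegralRep 2), r.domain = {x | ∀ i, x i ∈ Set.Ioo (0:ℝ) 1} → r'.domain = {x | ∀ i, x i ∈ Set.Ioo (0:ℝ) 1} → (∀ x ∈ r.domain, r.integrand x = r'.integrand (fun i => x i ^ m) * ((m : ℝ) ^ 2 * ∏ i, x i ^ (m - 1))) → KZ.of r - KZ.of r' ∈ KZ.changeOfVariablesRel) → ∀ (R : Polynomial ℚ), R.natDegree < 6 → ∃ b c : ℚ, ∀ (r r' : KZ.IntegralRep 2), r.domain = {x | ∀ i, x i ∈ Set.Ioo (0:ℝ) 1} → r'.domain = {x | ∀ i, x i ∈ Set.Ioo (0:ℝ) 1} → Set.EqOn r.integrand (fun x => Polynomial.aeval (x 0 * x 1) R / (1 - (x 0 * x 1) ^ 6)) r.domain → Set.EqOn r'.integrand (fun x =>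 (b : ℝ) / (1 - x 0 * x 1) + c / (1 + x 0 * x 1 + (x 0 * x 1) ^ 2)) r'.domain → KZ.Equivalent r r' := by
  sorry

/-! ## Composition: the stubs imply the crux

No definitions are introduced. Every intermediate representation lives on the SAME open box and is
built by the landed constructor `sectorRep` (`Theorems/ReductionTwoSix/Negative/NonVacuity`), whose
integrand is `sectorFun N = N(xy)/(1−(xy)⁶)`; a polynomial integrand `N(xy)` is `sectorFun (N·(1−X⁶))`. -/

section Composition

open Polynomial

/-- On the box, `sectorFun (N·(1−X⁶)) = N(xy)`: polynomial integrands as sector members. [folklore] -/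
theorem sectorFun_mul_oneSubX6 (N : ℚ[X]) {x : Fin 2 → ℝ} (hx : x ∈ box) :
    sectorFun (N * (1 - X ^ 6)) x = Polynomial.aeval (x 0 * x 1) N := by
  simp only [sectorFun, map_mul, map_sub, map_one, map_pow, Polynomial.aeval_X]
  rw [mul_div_assoc, div_self (one_sub_t6_ne hx), mul_one]

/-- On the box, `sectorFun (C q·(1−X⁶)) = q`: constants as sector members. [folklore] -/
theorem sectorFun_const (q : ℚ) {x : Fin 2 → ℝ} (hx : x ∈ box) :
    sectorFun (C q * (1 - X ^ 6)) x = (q : ℝ) := by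
  rw [sectorFun_C_mul, sectorFun_oneSubX6 hx, mul_one]

/-- On the box, `sectorFun (C b·(1+X+⋯+X⁵) + C c·(1−X+X³−X⁴)) = b/(1−xy) + c/(1+xy+x²y²)`. [folklore] -/
theorem sectorFun_polar (b c : ℚ) {x : Fin 2 → ℝ} (hx : x ∈ box) :
    sectorFun (C b * (1 + X + X ^ 2 + X ^ 3 + X ^ 4 + X ^ 5) + C c * (1 - X + X ^ 3 - X ^ 4)) x =
      (b : ℝ) / (1 - x 0 * x 1) + c / (1 + x 0 * x 1 + (x 0 * x 1) ^ 2) := by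
  rw [sectorFun_add, sectorFun_C_mul, sectorFun_C_mul, sectorFun_pole hx, sectorFun_cubic hx]
  ring

/-- Euclid by `X⁶ − 1` read on the box: `P(t)/(1−t⁶) = R(t)/(1−t⁶) + (−Q)(t)` for `P = R + (X⁶−1)·Q`.
[folklore] -/
theorem sectorFun_euclid (R Qt : ℚ[X]) {x : Fin 2 → ℝ} (hx : x ∈ box) :
    sectorFun (R + q6 * Qt) x = sectorFun R x + sectorFun (-Qt * (1 - X ^ 6)) x := by
  rw [sectorFun_mul_oneSubX6 _ hx]
  have h6 := one_sub_t6_ne hx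
  unfold q6
  simp only [sectorFun, map_add, map_mul, map_sub, map_neg, map_pow, map_one, Polynomial.aeval_X]
  generalize x 0 * x 1 = t at h6 ⊢
  field_simp
  ring

/-- **The crux `ReductionTwoSix` from the stubs of line `jacobian-monomials`.** Euclid
`P = R + (X⁶−1)·Q`; integrand additivity splits `[P(t)/(1−t⁶)]_B = [R(t)/(1−t⁶)]_B + [(−Q)(t)]_B`;
`stub_polarPartLevelSix` moves the first summand to `[b/(1−t)+c/(1+t+t²)]_B`,
`stub_polynomialPartByJacobians` (fed with `stub_boxDilation`) moves the second to the constant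
`[a]_B`, `a = Σ_k (−Q)_k/(k+1)²`; integrand additivity reassembles the normal form
`[a + b/(1−t) + c/(1+t+t²)]_B`. [cite: KontsevichZagier2001, §1.2] -/
theorem reductionTwoSix_proof :
    Summit.KontsevichZagierPeriods.KontsevichZagierPeriods.Theses.HurwitzMicroSectors.ReductionTwoSix := by
  intro r P hdom hint
  -- `1/(1−xy)` is integrable on the open unit box (Literature: Beukers' `ζ(2)` integral)
  have hI : IntegrableOn (fun x : Fin 2 → ℝ => 1 / (1 - x 0 * x 1)) box :=
    box_integral_one_div_one_sub_mul_two.1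
  -- Euclid by `X⁶ − 1`
  obtain ⟨R, hRdef⟩ : ∃ R : ℚ[X], R = P %ₘ q6 := ⟨_, rfl⟩
  obtain ⟨Qt, hQdef⟩ : ∃ Qt : ℚ[X], Qt = P /ₘ q6 := ⟨_, rfl⟩
  have hP : P = R + q6 * Qt := by rw [hRdef, hQdef, Polynomial.modByMonic_add_div P q6]
  have hR : R.natDegree < 6 := by
    rw [hRdef, ← natDegree_q6]; exact Polynomial.natDegree_modByMonic_lt P q6_monic q6_ne_one
  -- the polar coefficients (stub C) and the constant of the polynomial part `−Q` (stub B)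
  obtain ⟨b, c, hbc⟩ := stub_polarPartLevelSix stub_boxDilation R hR
  obtain ⟨a, ha⟩ : ∃ a : ℚ,
      a = ∑ k ∈ Finset.range ((-Qt).natDegree + 1), (-Qt).coeff k / ((k : ℚ) + 1) ^ 2 := ⟨_, rfl⟩
  -- the witness: the normal-form member of the sector
  refine ⟨a, b, c, sectorRep hI (nfPoly a b c), rfl, fun x hx => sectorFun_nfPoly a b c hx, ?_⟩
  rw [← cls_eq_iff]
  -- step 1 (integrand additivity): `[r] = [R(t)/(1−t⁶)] + [(−Q)(t)]`
  have h1 : cls r = cls (sectorRep hI R) + cls (sectorRep hI (-Qt * (1 - X ^ 6))) :=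
    cls_add r _ _ (by rw [hdom]; rfl) (by rw [hdom]; rfl) fun x hx => by
      have hx' : x ∈ box := by rw [hdom] at hx; exact hx
      rw [hint hx, Pi.add_apply, sectorRep_integrand, sectorRep_integrand, ← sectorFun_euclid R Qt hx',
        ← hP]
      rfl
  -- step 2 (stub C): the polar part
  have h2 : cls (sectorRep hI R) =
      cls (sectorRep hI (C b * (1 + X + X ^ 2 + X ^ 3 + X ^ 4 + X ^ 5) + C c * (1 - X + X ^ 3 - X ^ 4))) :=
    cls_eq_iff.mpr (hbc _ _ rfl rfl (fun _ _ => rfl) fun x hx => sectorFun_polar b c hx)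
  -- step 3 (stub B with stub A): the polynomial part is a constant
  have h3 : cls (sectorRep hI (-Qt * (1 - X ^ 6))) = cls (sectorRep hI (C a * (1 - X ^ 6))) :=
    cls_eq_iff.mpr (stub_polynomialPartByJacobians stub_boxDilation (-Qt) _ _ rfl rfl
      (fun x hx => sectorFun_mul_oneSubX6 (-Qt) hx) fun x hx => by
        rw [← ha]; exact sectorFun_const a hx)
  -- step 4 (integrand additivity): the normal form is the sum of the two reduced parts
  have h4 : cls (sectorRep hI (nfPoly a b c)) = cls (sectorRep hI (C a * (1 - X ^ 6))) +
      cls (sectorRep hI (C b * (1 + X + X ^ 2 + X ^ 3 + X ^ 4 + X ^ 5) + C c * (1 - X + X ^ 3 - X ^ 4))) :=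
    cls_add _ _ _ rfl rfl fun x hx => by
      rw [Pi.add_apply, sectorRep_integrand, sectorRep_integrand, sectorRep_integrand,
        sectorFun_nfPoly a b c hx, sectorFun_const a hx, sectorFun_polar b c hx]
      ring
  rw [h1, h2, h3, h4, add_comm]

end Composition

end Summit.KontsevichZagierPeriods.HurwitzMicroSectors.ReductionTwoSix

end
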